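import Literature.MathematicalPhysics.QuantumFieldTheory.Balaban1983to89.B9Eq326G1PostcompRowOfLetters
import Literature.MathematicalPhysics.QuantumFieldTheory.Balaban1983to89.B9Eq326LocalPartTowerDivergenceRowDiagonalClosed
import Literature.MathematicalPhysics.QuantumFieldTheory.Balaban1983to89.B9Eq326WoodburyLettersTower
import Literature.MathematicalPhysics.QuantumFieldTheory.Balaban1983to89.B9Eq326WoodburySchurTower
import Literature.MathematicalPhysics.QuantumFieldTheory.Balaban1983to89.B9Eq326DeltaABlockDecayTowerDiagonalClosed
import Literature.MathematicalPhysics.QuantumFieldTheory.Balaban1983to89.B9Eq326LocalPartCoerciveTower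
import Literature.MathematicalPhysics.QuantumFieldTheory.Balaban1983to89.B9Eq342GreenPrimeTowerGradientRowClosed
import Literature.MathematicalPhysics.QuantumFieldTheory.Balaban1983to89.B9Eq324PenaltyPointwiseBound
import Literature.MathematicalPhysics.QuantumFieldTheory.Balaban1983to89.B9Eq33CovDerivLocalLetterTower

/-!
# `Balaban1983to89.B9Eq326G1kDivergenceRowClosed` — T. Bałaban, *Propagators for lattice gauge theories in a background field*, Commun. Math. Phys. **99**
# (1985) 389–434 [Balaban1985BackgroundPropagators] Thm 3.3 p. 399 (*«the operator G(U) satisfies the inequalities (3.42)–(3.47), with G′(U) replaced by G(U)»*)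
# with Thm 3.1 (3.42) p. 397 SECOND ENTRY (*«|(∇_U Gλ)(x)| ≤ B₀e^{−δ₀d(y,y′)}|λ|, x ∈ Δ(y), supp λ ⊂ Δ(y′)»*, «δ₀, B₀ dependent on d and L only»), (3.8) p. 392 (the
# covariant divergence), (3.25)–(3.26) pp. 394–395 (`Δ_a(U) = Δ(U) + D_UR(U)D*_U + Q*(U)aQ(U)`, `G = Δ_a⁻¹`): **THE DIVERGENCE ROW OF THE BOND PROPAGATOR
# `G₁,k(U) = Δ_{a,k}(U)⁻¹` (`B9Eq326OperatorTower.G1k`) ON PRINT's DIAGONAL, `∃ (α₁, B, δ)` BEFORE THE HEIGHT: for every `n, η (ηL^{n+1} = 1), c₀, c₁, m`, every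
# background `U` of the cell's MODEL letters in the window `α ≤ α₁`, every bond source `f` supported over ONE unit block `v` with `‖f(b)‖ ≤ F`, every fine site
# `y`: `‖(D*_U G₁,k(U) f)(y)‖ ≤ B·e^{−δ·d_m(Πy, v)}·F`** — the divergence companion of ne9-leaf-05's (K64) `B9Eq326G1kSupRowClosed.exists_local_letter_G1k`
# (beta-an4's `G₁,k` sup row), by the same Woodbury road around the local part `A₀,k`: `D*_UG₁,k = D*_UA₀,k⁻¹ + (D*_UA₀,k⁻¹)∘Uu∘[c + c∘V∘G₁,k∘Uu∘c]∘V∘A₀,k⁻¹`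
# (this lineage's (WST) `B9Eq326WoodburySchurTower.G1k_eq_woodbury`), the left factor `D*_UA₀,k⁻¹` being this lineage's storey-J row (DVTD)
# `B9Eq326LocalPartTowerDivergenceRowDiagonalClosed.exists_divergence_row_localInvK_diagonal_closed`, the assembly the OWNER t4-ne9-p1 g96's (E1)
# `B9Eq326G1PostcompRowOfLetters.local_letter_postcomp_torus_const` (post-composition of (K61)∕(K62) by a CLM `D`), and EVERY OTHER INPUT EXACTLY AS IN (K64): (ECL) for `A₀,k⁻¹`, (FCLG) for the `L²` block decay
# of `G₁,k`, (K64a) for `c_k` and the adjoint facts, the OWNER t4-ne9-p1's (GRC) for `Uu = D_UG′_kQ̃′_k†` (the row named in the OWNER's PRE-INTENT-6 (DVT):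
# «`D*_UG₁,k = D*_UA₀,k⁻¹ + …` by Woodbury», journal l.65114)
statement-level skeleton of published theorems with citation tags; proofs where landed; nothing here is a claim about the Yang–Mills mass gap

CITATION HEADER (lean-in-tree rule).  Audit cell `pub-balaban`, sub-cell `t4`, BINDER row NE9; filed by NE9 crux-team LEAF PROVER 03 (`b2b-balaban-t4-ne9-formalise-leaf-03`,
gen 79; road ΔA-CT).  THE PLUMBING OF THIS FILE IS ne9-leaf-05 g87's (K64) `B9Eq326G1kSupRowClosed` (`exists_local_letter_G1k_of_UuLetter` ∕ `exists_local_letter_G1k`),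
VERBATIM but for the left factor `D*_U` — credited; imports: the OWNER g96's (E1) `B9Eq326G1PostcompRowOfLetters`, this lineage's (DVTD), (WST), (FCLG), (LPC); ne9-leaf-05's
(K64a) `B9Eq326WoodburyLettersTower`; the OWNER's (GRC) `B9Eq342GreenPrimeTowerGradientRowClosed`; `B9Eq324PenaltyPointwiseBound`, `B9Eq33CovDerivLocalLetterTower`.
SOURCE READ first-hand [Balaban1985BackgroundPropagators] (`paper:balaban1985-cmp99-background-propagators`, journal page = PDF page + 388): p. 397 Thm 3.1 (3.42);
p. 399 Thm 3.3, (3.49); p. 392 (3.8); pp. 394–395 (3.25)–(3.26); p. 393 (3.19); p. 416 Thm 3.11.  Print's random walk (pp. 415–434) is NOT reproduced; [folklore].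

WHAT IS PROVED (sorry-free; proof lane — no `def`).
* §1 **`exists_divergence_row_G1k_of_UuLetter`** — GIVEN `HU` (the `∃`-first letter of `Uu` on unit point sources, the SAME hypothesis byte for byte as (K64)
  §1's), `∃ α₁ B δ` BEFORE the (K64) `∀`-block (`… hUst hUb hUη hpl hUgrad hRlev hεg hAQ hpos′ hpos v f F hfv hfF`) and a fine site `y`:
  `‖(D*_U(G₁,k f))(y)‖ ≤ B·e^{−δ·d_m(Πy, v)}·F`; `α₁ := min` of the five suppliers' thresholds ((ECL), (FCLG), (K64a), `HU`, (DVTD)), common rate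
  `κ := min(δ_A, r₁, ρ_c, κ_U, δ_D)`, `δ := κ∕2`, `B = B_D + B_D·B_U·B_c·(B_U·B_A·K·d)·K³·(1 + B_c·((B_U√d)·A₁·(B_U√d)·K²·1)·K²)`, `K = K_d(κ∕4)`.
* §2 **`exists_divergence_row_G1k`** — THE SAME, UNCONDITIONAL on the MODEL letters: `HU` inhabited by (GRC) exactly as (K64) §2 does.
HONEST SCOPE.  [folklore] plumbing; a theorem about the cell's MODEL (unitary `U` with `star U = U⁻¹`, `‖U(b) − 1‖ ≤ αη`, plaquettes `≤ αη²`, the bond-gradient datum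
`≤ αη²`, the `Q_k` regularity letters, contractive level averages `hRlev`, tracial norming); `B` crude; the positivity witnesses `hpos′` ([B9] (3.24)) and `hpos`
([B9] Thm 3.11) stay DISPLAYED; nothing of [B9] Thm 3.1∕3.3∕3.11 is asserted, valued or discharged.  NOT NE9 (cell pub-balaban: NE9 NOT PRINTED ∕ NOT PROVED; «NE9 ⇐
the named binders»; row WALLED ON A MODEL (O-NE9-1; #5 UNRULED); spine PROVED 0∕9; rung (B)+1 on a finite T⁴ — NOT infinite volume, NOT mass gap, NOT BetaPertH, NOT
Clay; HONEST DEPENDENCY: continuum YM on T⁴ ⇐ BetaPertH ∧ nine spine estimates (0/9 proved); BetaPertH ⇐ (D1) ∧ (D4) ∧ CAP+tail; G-an2-4 gates asym, D1 and NE2/3/4).  NEW file.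
-/

noncomputable section

set_option autoImplicit false
open scoped InnerProductSpace ComplexConjugate BigOperators

namespace Literature.MathematicalPhysics.QuantumFieldTheory.Balaban1983to89.B9Eq326G1kDivergenceRowClosed

open B4Sect5Torus (TSite tdist tdist_nonneg tdist_triangle)
open B4Sect5Proof (latticeConst latticeConst_nonneg)
open B9SectCLatticeCarrier (Bond DirPair bpos btgt unshift)
open B9Eq311L2Pairing (WL2)
open B9Eq319QprimeTorus (fineP blockCoord)
open B7Prop1Explicit (U1 Wcx boxVec)
open B11Eq103H1Complex (SiteL2K BondL2K greenK covDerivL2K covDivL2K)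
open B9Eq310DeltaPrime (plaqHolU)
open B9Eq310HessianOperator (adTransportW hessOp)
open B9Eq310HessianHermitian (adTransportW_adjoint)
open B9Eq315QTorus (perCfg cornerSite)
open B9Eq315QTower (towerP UlevOf)
open B9Eq316TowerFlatIsOneStep (towerP_eq_fineP_pow siteCast)
open B9Eq326OperatorTower (QkW QprimeTowerW laplaceAk G1k)
open B9Eq324DeltaPrimeATower (laplacePrimeAk GpOfUk)
open B9Eq325ProjFormulaTower (QGGQk_pos)
open B9Eq349BlockMultipliers (exists_block_clm_family)
open B9Eq326LocalPartCoerciveTower (localK_pos_of_pos)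
open B9Eq326WoodburySchurTower (G1k_eq_woodbury)
open B9Eq326WoodburyLettersTower (adjoint_toContinuousLinearMap_Uu adjoint_localInvK exists_local_letter_QGGQInvk_closed)
open B9Eq326LocalPartTowerSupDecayDiagonalClosed (sum_bondMass_bigBlock_le exists_sup_decay_localInvK_diagonal_closed)
open B9Eq326DeltaABlockDecayTowerDiagonalClosed (exists_block_decay_G1k_diagonal_closed)
open B9Eq326G1PostcompRowOfLetters (local_letter_postcomp_torus_const)
open B9Eq326LocalPartTowerDivergenceRowDiagonalClosed (exists_divergence_row_localInvK_diagonal_closed)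
open B9Eq342GreenPrimeTowerGradientRowClosed (exists_gradRow_GpOfUk)
open B9Eq324PenaltyPointwiseBound (norm_adjoint_QtildeTower_apply_le)
open B9Eq324PenaltyBlockLocal (adjoint_QtildeTower_apply_eq_of_eq_at)
open B9Eq342GreenPrimeTowerSupBoundDecay (bigBlock_eq_iff)
open B9Eq33CovDerivLocalLetterTower (tdist_bigBlock_bpos_btgt_le_one)
open B9Eq347LocalFromBlockDecay (norm_le_sqrt_mass_mul)

variable {d : ℕ} (hd : 1 ≤ d) (L : ℕ) [NeZero L] (hL : 1 ≤ L) (hL3 : 3 ≤ L)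
  {𝔸 : Type*} [NormedRing 𝔸] [NormedAlgebra ℂ 𝔸] [CompleteSpace 𝔸] [NormOneClass 𝔸] [StarRing 𝔸] [NormedStarGroup 𝔸] [StarModule ℂ 𝔸]
  {W : Type*} [NormedAddCommGroup W] [InnerProductSpace ℂ W] [FiniteDimensional ℂ W] (φ : W ≃ₗ[ℂ] 𝔸)
  {Mφ Mφ' : ℝ} (hMφ : 0 ≤ Mφ) (hMφ' : 0 ≤ Mφ') (hφ : ∀ w, ‖φ w‖ ≤ Mφ * ‖w‖) (hφ' : ∀ X, ‖φ.symm X‖ ≤ Mφ' * ‖X‖) (hstar : ∀ X : 𝔸, ‖star X‖ ≤ ‖X‖)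
  {a : ℝ} (ha : 0 < a) {a' : ℝ} (ha' : 0 < a') {ϱ : ℝ} (hϱ0 : 0 ≤ ϱ) (hϱ1 : ϱ < 1)
  (τ : 𝔸 →ₗ[ℂ] ℂ) {Cτ : ℝ} (hτ : ∀ X, ‖τ X‖ ≤ Cτ * ‖X‖) (hCτ : 0 ≤ Cτ) {Mτ : ℝ} (hτm : ∀ X Y : 𝔸, ‖τ (X * Y)‖ ≤ Mτ * ‖X‖ * ‖Y‖) (hMτ : 0 ≤ Mτ)
  {ρw : ℝ} (hρw : 0 ≤ ρw)
  (hτ₁ : ∀ X : 𝔸, τ (star X) = conj (τ X)) (hτ₂ : ∀ X Y : 𝔸, τ (X * Y) = τ (Y * X)) (hφτ : ∀ X Y : 𝔸, ⟪φ.symm X, φ.symm Y⟫_ℂ = τ (star X * Y))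
  (AQ : ℝ)

omit [NeZero L] in
/-- `e^{−r t} ≤ e^{−κ t}` for `κ ≤ r`, `0 ≤ t`. [folklore] -/
private theorem exp_weaken {r κ t : ℝ} (hκ : κ ≤ r) (ht : 0 ≤ t) : Real.exp (-(r * t)) ≤ Real.exp (-(κ * t)) :=
  Real.exp_le_exp.2 (by nlinarith)

/-! ## §1 The divergence row of `G₁,k` modulo the letter of `Uu = D_UG′_kQ̃′_k†` -/

include hd hL hL3 hMφ hMφ' hφ hφ' hstar ha ha' hϱ0 hϱ1 hτ hCτ hτm hMτ hρw hτ₁ hτ₂ hφτ in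
/-- **THE DIVERGENCE ROW OF `G₁,k(U)` ON PRINT's DIAGONAL, `∃ α₁ B δ` BEFORE THE HEIGHT — MODULO THE DISPLAYED `∃`-FIRST LETTER OF `Uu = D_UG′_kQ̃′_k†`**
(`HU` — the SAME hypothesis, byte for byte, as ne9-leaf-05's (K64) `B9Eq326G1kSupRowClosed.exists_local_letter_G1k_of_UuLetter`; inhabited in §2 exactly as
there).  Composition BY NAME of the OWNER g96's (E1) `B9Eq326G1PostcompRowOfLetters.local_letter_postcomp_torus_const` with `hW` := (WST) `G1k_eq_woodbury`,
`hVadj`∕`hAadj`∕`hC` := (K64a) `B9Eq326WoodburyLettersTower`, (L)(D*_UA₀,k⁻¹) := (DVTD) `exists_divergence_row_localInvK_diagonal_closed`, (L)(A₀,k⁻¹) := (ECL),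
`hGblk` := (FCLG), the families by `exists_block_clm_family`, the bond-block mass `d·c₁` by (ECL) §1 — the plumbing is (K64) §1's, verbatim but for the
left factor `D*_U`. [cite: Balaban1985BackgroundPropagators, Thm 3.3 p.399, Thm 3.1 (3.42) p.397 (second entry), (3.8) p.392, (3.25)–(3.26) pp.394–395, Thm 3.11 p.416] -/
theorem exists_divergence_row_G1k_of_UuLetter
    (HU : ∃ α₂ BU κU : ℝ, 0 < α₂ ∧ 0 ≤ BU ∧ 0 < κU ∧
      ∀ (n : ℕ) (η : ℝ) (_hηL : η * (L : ℝ) ^ (n + 1) = 1) (c₀ c₁ : ℝ) [Fact (0 < c₀)] [Fact (0 < c₁)]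
        (_hw : c₀ * ((L : ℝ) ^ (n + 1)) ^ d = c₁) (_hρ : |η| ^ d / c₀ ≤ ρw) (m : Fin d → ℕ) [∀ i, NeZero (m i)] (_hm : ∀ i, 1 ≤ m i)
        (U : Bond d (towerP L m (n + 1)) → 𝔸ˣ) (αU : ℕ → ℝ) (_hα0 : ∀ j, 0 ≤ αU j) (hα1 : ∀ j, αU j ≤ 1 / 64)
        (hU1 : ∀ (j : ℕ) (x : B7Prop1Explicit.Site d) (k : Fin d), perCfg (towerP L m (j + 1)) (UlevOf L m (n + 1) U j) x k ∈ U1 𝔸)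
        (hreg : ∀ (j : ℕ) (y : TSite d (towerP L m j)) (k : Fin d) (ρ' : Fin d → Fin L),
          ‖((Wcx L (perCfg (towerP L m (j + 1)) (UlevOf L m (n + 1) U j)) (cornerSite L y) k (boxVec L ρ') : 𝔸ˣ) : 𝔸) - 1‖ ≤ αU j)
        (εU : ℕ → ℝ) (_hεU : ∀ j, 0 ≤ εU j) (_hUε : ∀ (j : ℕ) (b : Bond d (towerP L m (j + 1))), ‖(UlevOf L m (n + 1) U j b : 𝔸) - 1‖ ≤ εU j)
        (_hLb : ∀ (j : ℕ) (b : Bond d (towerP L m (j + 1))), UlevOf L m (n + 1) U j b ∈ U1 𝔸)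
        (α : ℝ) (_hα : 0 ≤ α) (_hαle : α ≤ α₂)
        (hUst : ∀ b, star (U b : 𝔸) = (((U b)⁻¹ : 𝔸ˣ) : 𝔸)) (_hUb : ∀ b, U b ∈ U1 𝔸) (_hUη : ∀ b, ‖(U b : 𝔸) - 1‖ ≤ α * η)
        (_hpl : ∀ p : B9SectCLatticeCarrier.Plaq d (towerP L m (n + 1)), ‖(plaqHolU U p : 𝔸) - 1‖ ≤ α * η ^ 2)
        (_hUgrad : ∀ (x : TSite d (towerP L m (n + 1))) (μ : Fin d), ‖(U (x, μ) : 𝔸) - U (unshift μ x, μ)‖ ≤ α * η ^ 2)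
        (_hRlev : ∀ (j : ℕ) (b : Bond d (towerP L m (j + 1))) (w : W), ‖adTransportW φ (UlevOf L m (n + 1) U j) b w‖ ≤ ‖w‖)
        (_hεg : ∀ j < n + 1, εU j ≤ α * ϱ ^ j) (_hAQ : ∑ j ∈ Finset.range (n + 1), αU j ≤ AQ)
        (hpos' : ∀ x : SiteL2K ℂ d (towerP L m (n + 1)) c₀ W, x ≠ 0 → 0 < RCLike.re ⟪x, laplacePrimeAk L m n φ η U a' (c₁ := c₁) x⟫_ℂ)
        (v : TSite d m) (g : SiteL2K ℂ d m c₁ W) (Gs : ℝ) (_hgv : ∀ y, y ≠ v → WL2.equiv ℂ (fun _ : TSite d m => c₁) W g y = 0)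
        (_hgG : ∀ y, ‖WL2.equiv ℂ (fun _ : TSite d m => c₁) W g y‖ ≤ Gs) (b : Bond d (towerP L m (n + 1))),
        ‖WL2.equiv ℂ (fun _ : Bond d (towerP L m (n + 1)) => c₀) W
            ((covDerivL2K ℂ c₀ ((η : ℂ))⁻¹ (adTransportW φ U) ∘ₗ GpOfUk L m n φ η U a' (c₁ := c₁) hpos' ∘ₗ
              LinearMap.adjoint ((WL2.linearEquiv ℂ ℂ (fun _ : TSite d m => c₁)).symm.toLinearMap ∘ₗ QprimeTowerW L m n φ U (c₀ := c₀))) g) b‖ ≤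
          BU * Real.exp (-(κU * tdist m (blockCoord (L ^ (n + 1)) m (siteCast (towerP_eq_fineP_pow L m (n + 1)) (bpos b))) v)) * Gs) :
    ∃ α₁ B δ : ℝ, 0 < α₁ ∧ 0 ≤ B ∧ 0 < δ ∧
      ∀ (n : ℕ) (η : ℝ) (_hηL : η * (L : ℝ) ^ (n + 1) = 1) (c₀ c₁ : ℝ) [Fact (0 < c₀)] [Fact (0 < c₁)]
        (_hw : c₀ * ((L : ℝ) ^ (n + 1)) ^ d = c₁) (_hρ : |η| ^ d / c₀ ≤ ρw) (m : Fin d → ℕ) [∀ i, NeZero (m i)] (_hm : ∀ i, 1 ≤ m i)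
        (U : Bond d (towerP L m (n + 1)) → 𝔸ˣ) (αU : ℕ → ℝ) (_hα0 : ∀ j, 0 ≤ αU j) (hα1 : ∀ j, αU j ≤ 1 / 64)
        (hU1 : ∀ (j : ℕ) (x : B7Prop1Explicit.Site d) (k : Fin d), perCfg (towerP L m (j + 1)) (UlevOf L m (n + 1) U j) x k ∈ U1 𝔸)
        (hreg : ∀ (j : ℕ) (y : TSite d (towerP L m j)) (k : Fin d) (ρ' : Fin d → Fin L),
          ‖((Wcx L (perCfg (towerP L m (j + 1)) (UlevOf L m (n + 1) U j)) (cornerSite L y) k (boxVec L ρ') : 𝔸ˣ) : 𝔸) - 1‖ ≤ αU j)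
        (εU : ℕ → ℝ) (_hεU : ∀ j, 0 ≤ εU j) (_hUε : ∀ (j : ℕ) (b : Bond d (towerP L m (j + 1))), ‖(UlevOf L m (n + 1) U j b : 𝔸) - 1‖ ≤ εU j)
        (_hLb : ∀ (j : ℕ) (b : Bond d (towerP L m (j + 1))), UlevOf L m (n + 1) U j b ∈ U1 𝔸)
        (α : ℝ) (_hα : 0 ≤ α) (_hαle : α ≤ α₁)
        (hUst : ∀ b, star (U b : 𝔸) = (((U b)⁻¹ : 𝔸ˣ) : 𝔸)) (_hUb : ∀ b, U b ∈ U1 𝔸) (_hUη : ∀ b, ‖(U b : 𝔸) - 1‖ ≤ α * η)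
        (_hpl : ∀ p : B9SectCLatticeCarrier.Plaq d (towerP L m (n + 1)), ‖(plaqHolU U p : 𝔸) - 1‖ ≤ α * η ^ 2)
        (_hUgrad : ∀ (x : TSite d (towerP L m (n + 1))) (μ : Fin d), ‖(U (x, μ) : 𝔸) - U (unshift μ x, μ)‖ ≤ α * η ^ 2)
        (_hRlev : ∀ (j : ℕ) (b : Bond d (towerP L m (j + 1))) (w : W), ‖adTransportW φ (UlevOf L m (n + 1) U j) b w‖ ≤ ‖w‖)
        (_hεg : ∀ j < n + 1, εU j ≤ α * ϱ ^ j) (_hAQ : ∑ j ∈ Finset.range (n + 1), αU j ≤ AQ)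
        (hpos' : ∀ x : SiteL2K ℂ d (towerP L m (n + 1)) c₀ W, x ≠ 0 → 0 < RCLike.re ⟪x, laplacePrimeAk L m n φ η U a' (c₁ := c₁) x⟫_ℂ)
        (hpos : ∀ x : BondL2K ℂ d (towerP L m (n + 1)) c₀ W, x ≠ 0 →
          0 < RCLike.re ⟪x, laplaceAk L m n φ η U hL αU hα1 hU1 hreg τ (c₀ := c₀) (c₁ := c₁) a x⟫_ℂ)
        (v : TSite d m) (f : BondL2K ℂ d (towerP L m (n + 1)) c₀ W) (F : ℝ)
        (_hfv : ∀ b, blockCoord (L ^ (n + 1)) m (siteCast (towerP_eq_fineP_pow L m (n + 1)) (bpos b)) ≠ v →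
          WL2.equiv ℂ (fun _ : Bond d (towerP L m (n + 1)) => c₀) W f b = 0)
        (_hfF : ∀ b, ‖WL2.equiv ℂ (fun _ : Bond d (towerP L m (n + 1)) => c₀) W f b‖ ≤ F) (y : TSite d (towerP L m (n + 1))),
        ‖WL2.equiv ℂ (fun _ : TSite d (towerP L m (n + 1)) => c₀) W (covDivL2K ℂ c₀ ((η : ℂ))⁻¹ (adTransportW φ fun bb => (U bb)⁻¹)
            (G1k L m n φ η U hL αU hα1 hU1 hreg τ (c₀ := c₀) (c₁ := c₁) hpos f)) y‖ ≤
          B * Real.exp (-(δ * tdist m (blockCoord (L ^ (n + 1)) m (siteCast (towerP_eq_fineP_pow L m (n + 1)) y)) v)) * F := by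
  classical
  -- the four `∃`-first suppliers
  obtain ⟨αA, BA, δA, hαA, hBA, hδA, HA⟩ := exists_sup_decay_localInvK_diagonal_closed hd L hL hL3 φ hMφ hMφ' hφ hφ' hstar ha ha' hϱ0 hϱ1 τ hτ hCτ hτm
    hMτ hρw hτ₁ hτ₂ hφτ AQ
  obtain ⟨αG, r₁, A₁, hαG, hr₁, hA₁, HG⟩ := exists_block_decay_G1k_diagonal_closed hd L hL hL3 φ hMφ hMφ' hφ hφ' hstar ha ha' hϱ0 hϱ1 τ hτ hCτ hτm hMτ
    hρw hτ₁ hτ₂ hφτ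
  obtain ⟨αC, BC, ρC, hαC, hBC, hρC, HC⟩ := exists_local_letter_QGGQInvk_closed hd L hL hL3 φ hMφ hMφ' hφ hφ' ha ha' hϱ0 hϱ1 τ hτ hCτ hρw hτ₁ hτ₂ hφτ hMτ
  obtain ⟨αD, BD, δD, hαD, hBD, hδD, HDA⟩ := exists_divergence_row_localInvK_diagonal_closed hd L hL hL3 φ hMφ hMφ' hφ hφ' hstar ha ha' hϱ0 hϱ1 τ hτ hCτ
    hτm hMτ hρw hτ₁ hτ₂ hφτ AQ
  obtain ⟨αB, BU, κU, hαB, hBU, hκU, HB⟩ := HU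
  -- one window, one rate
  set αs : ℝ := min (min (min αA αG) (min αC αB)) αD with hαs
  have hαs0 : 0 < αs := lt_min (lt_min (lt_min hαA hαG) (lt_min hαC hαB)) hαD
  have hαs4 : αs ≤ min (min αA αG) (min αC αB) := min_le_left _ _
  have hαsD : αs ≤ αD := min_le_right _ _
  set κ : ℝ := min (min (min δA r₁) (min ρC κU)) δD with hκdef
  have hκ0 : 0 < κ := lt_min (lt_min (lt_min hδA hr₁) (lt_min hρC hκU)) hδD
  have hκA : κ ≤ δA := (min_le_left _ _).trans ((min_le_left _ _).trans (min_le_left _ _))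
  have hκG : κ ≤ r₁ := (min_le_left _ _).trans ((min_le_left _ _).trans (min_le_right _ _))
  have hκC : κ ≤ ρC := (min_le_left _ _).trans ((min_le_right _ _).trans (min_le_left _ _))
  have hκB : κ ≤ κU := (min_le_left _ _).trans ((min_le_right _ _).trans (min_le_right _ _))
  have hκD : κ ≤ δD := min_le_right _ _
  set K : ℝ := latticeConst d ((κ - κ / 2) / 2) with hKdef
  set Bs : ℝ := BD + BD * BU * BC * (BU * BA * K * d) * K ^ 3 * (1 + BC * ((BU * Real.sqrt d) * A₁ * (BU * Real.sqrt d) * K ^ 2 * 1) * K ^ 2)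
    with hBs
  have hK0 : 0 ≤ K := latticeConst_nonneg d (div_nonneg (by linarith) (by norm_num))
  have hBs0 : 0 ≤ Bs := by positivity
  refine ⟨αs, Bs, κ / 2, hαs0, hBs0, by positivity, ?_⟩
  intro n η hηL c₀ c₁ _ _ hw hρ m _ hm U αU hα0 hα1 hU1 hreg εU hεU hUε hLb α hα hαle' hUst hUb hUη hpl hUgrad hRlev hεg hAQ hpos' hpos v f F hfv hfF y
  have hαle : α ≤ min (min αA αG) (min αC αB) := hαle'.trans hαs4
  have hc₀ : (0 : ℝ) < c₀ := Fact.out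
  have hc₁ : (0 : ℝ) < c₁ := Fact.out
  have hF0 : 0 ≤ F := (norm_nonneg _).trans (hfF (y, ⟨0, hd⟩))
  have hRS : ∀ (b : Bond d (towerP L m (n + 1))) (v u : W), ⟪adTransportW φ U b v, u⟫_ℂ = ⟪v, adTransportW φ (fun b => (U b)⁻¹) b u⟫_ℂ :=
    adTransportW_adjoint φ τ hτ₂ hUst hφτ
  -- the local part, its positivity, the Woodbury letters
  obtain ⟨A₀, hA₀⟩ : ∃ A₀ : BondL2K ℂ d (towerP L m (n + 1)) c₀ W →ₗ[ℂ] BondL2K ℂ d (towerP L m (n + 1)) c₀ W,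
      A₀ = hessOp φ η U τ + covDerivL2K ℂ c₀ ((η : ℂ))⁻¹ (adTransportW φ U) ∘ₗ covDivL2K ℂ c₀ ((η : ℂ))⁻¹ (adTransportW φ fun b => (U b)⁻¹) +
        LinearMap.adjoint (QkW L m n φ U hL αU hα1 hU1 hreg (c₀ := c₀) (c₁ := c₁)) ∘ₗ ((a : ℂ) • QkW L m n φ U hL αU hα1 hU1 hreg (c₀ := c₀) (c₁ := c₁)) :=
    ⟨_, rfl⟩
  have hpos₀ : ∀ x : BondL2K ℂ d (towerP L m (n + 1)) c₀ W, x ≠ 0 → 0 < RCLike.re ⟪x, A₀ x⟫_ℂ :=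
    localK_pos_of_pos L m n φ η U τ hRS hL αU hα1 hU1 hreg a A₀ hA₀ hpos
  obtain ⟨Uu, hUu⟩ : ∃ Uu : SiteL2K ℂ d m c₁ W →ₗ[ℂ] BondL2K ℂ d (towerP L m (n + 1)) c₀ W,
      Uu = covDerivL2K ℂ c₀ ((η : ℂ))⁻¹ (adTransportW φ U) ∘ₗ GpOfUk L m n φ η U a' (c₁ := c₁) hpos' ∘ₗ
        LinearMap.adjoint ((WL2.linearEquiv ℂ ℂ (fun _ : TSite d m => c₁)).symm.toLinearMap ∘ₗ QprimeTowerW L m n φ U (c₀ := c₀)) := ⟨_, rfl⟩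
  obtain ⟨V, hV⟩ : ∃ V : BondL2K ℂ d (towerP L m (n + 1)) c₀ W →ₗ[ℂ] SiteL2K ℂ d m c₁ W,
      V = ((WL2.linearEquiv ℂ ℂ (fun _ : TSite d m => c₁)).symm.toLinearMap ∘ₗ QprimeTowerW L m n φ U (c₀ := c₀)) ∘ₗ
        GpOfUk L m n φ η U a' (c₁ := c₁) hpos' ∘ₗ covDivL2K ℂ c₀ ((η : ℂ))⁻¹ (adTransportW φ fun b => (U b)⁻¹) := ⟨_, rfl⟩
  obtain ⟨c, hc⟩ : ∃ c : SiteL2K ℂ d m c₁ W →ₗ[ℂ] SiteL2K ℂ d m c₁ W, c = greenK _ (QGGQk_pos L m n φ c₀ η U c₁ a' hRS hpos') := ⟨_, rfl⟩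
  have hWST := G1k_eq_woodbury L m n φ c₀ η U c₁ a' τ hRS hpos' hL αU hα1 hU1 hreg a A₀ hA₀ Uu hUu V hV hpos hpos₀
  -- the block families
  obtain ⟨PB, hPB⟩ := exists_block_clm_family (𝕜 := ℂ) (w := fun _ : Bond d (towerP L m (n + 1)) => c₀) (V := W)
    (fun b : Bond d (towerP L m (n + 1)) => blockCoord (L ^ (n + 1)) m (siteCast (towerP_eq_fineP_pow L m (n + 1)) (bpos b)))
  obtain ⟨rY, hrY⟩ := exists_block_clm_family (𝕜 := ℂ) (w := fun _ : TSite d m => c₁) (V := W) (id : TSite d m → TSite d m)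
  -- the CLMs
  obtain ⟨Acl, hAcl⟩ : ∃ T : BondL2K ℂ d (towerP L m (n + 1)) c₀ W →L[ℂ] BondL2K ℂ d (towerP L m (n + 1)) c₀ W,
      T = LinearMap.toContinuousLinearMap (greenK A₀ hpos₀) := ⟨_, rfl⟩
  obtain ⟨Gcl, hGcl⟩ : ∃ T : BondL2K ℂ d (towerP L m (n + 1)) c₀ W →L[ℂ] BondL2K ℂ d (towerP L m (n + 1)) c₀ W,
      T = LinearMap.toContinuousLinearMap (G1k L m n φ η U hL αU hα1 hU1 hreg τ (c₀ := c₀) (c₁ := c₁) hpos) := ⟨_, rfl⟩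
  obtain ⟨Ucl, hUcl⟩ : ∃ T : SiteL2K ℂ d m c₁ W →L[ℂ] BondL2K ℂ d (towerP L m (n + 1)) c₀ W, T = LinearMap.toContinuousLinearMap Uu := ⟨_, rfl⟩
  obtain ⟨Vcl, hVcl⟩ : ∃ T : BondL2K ℂ d (towerP L m (n + 1)) c₀ W →L[ℂ] SiteL2K ℂ d m c₁ W, T = LinearMap.toContinuousLinearMap V := ⟨_, rfl⟩
  obtain ⟨Ccl, hCcl⟩ : ∃ T : SiteL2K ℂ d m c₁ W →L[ℂ] SiteL2K ℂ d m c₁ W, T = LinearMap.toContinuousLinearMap c := ⟨_, rfl⟩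
  obtain ⟨Dcl, hDcl⟩ : ∃ T : BondL2K ℂ d (towerP L m (n + 1)) c₀ W →L[ℂ] SiteL2K ℂ d (towerP L m (n + 1)) c₀ W,
      T = LinearMap.toContinuousLinearMap (covDivL2K ℂ c₀ ((η : ℂ))⁻¹ (adTransportW φ fun bb => (U bb)⁻¹)) := ⟨_, rfl⟩
  -- hW pointwise
  have hW : ∀ f', Gcl f' = Acl f' + Acl (Ucl ((Ccl + Ccl ∘L Vcl ∘L Gcl ∘L Ucl ∘L Ccl) (Vcl (Acl f')))) := fun f' => by
    have e := congrArg (fun T : BondL2K ℂ d (towerP L m (n + 1)) c₀ W →ₗ[ℂ] BondL2K ℂ d (towerP L m (n + 1)) c₀ W => T f') hWST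
    simp only [LinearMap.add_apply, LinearMap.comp_apply] at e
    simp only [hAcl, hGcl, hUcl, hVcl, hCcl, hc, add_apply, ContinuousLinearMap.comp_apply, LinearMap.coe_toContinuousLinearMap']
    exact e
  -- the adjoint facts
  have hVadj : ContinuousLinearMap.adjoint Ucl = Vcl := by
    rw [hUcl, hVcl]; exact adjoint_toContinuousLinearMap_Uu L m n φ c₀ η U c₁ a' hRS hpos' Uu hUu V hV
  have hAadj : ContinuousLinearMap.adjoint Acl = Acl := by
    rw [hAcl]; exact (adjoint_localInvK L m n φ c₀ η U c₁ τ hL αU hα1 hU1 hreg a hUst hτ₁ hτ₂ hφτ A₀ hA₀ hpos₀).2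
  -- the five letters at this height, weakened to the common rate `κ`
  have hDAk : ∀ (v : TSite d m) (f : BondL2K ℂ d (towerP L m (n + 1)) c₀ W) (F : ℝ),
      (∀ x, blockCoord (L ^ (n + 1)) m (siteCast (towerP_eq_fineP_pow L m (n + 1)) (bpos x)) ≠ v →
        WL2.equiv ℂ (fun _ : Bond d (towerP L m (n + 1)) => c₀) W f x = 0) →
      (∀ x, ‖WL2.equiv ℂ (fun _ : Bond d (towerP L m (n + 1)) => c₀) W f x‖ ≤ F) →
      ∀ x : TSite d (towerP L m (n + 1)), ‖WL2.equiv ℂ (fun _ : TSite d (towerP L m (n + 1)) => c₀) W ((Dcl ∘L Acl) f) x‖ ≤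
        BD * Real.exp (-(κ * tdist m (blockCoord (L ^ (n + 1)) m (siteCast (towerP_eq_fineP_pow L m (n + 1)) x)) v)) * F := by
    intro v f F hfv hfF x
    have hF : 0 ≤ F := (norm_nonneg _).trans (hfF (x, ⟨0, hd⟩))
    have h := HDA n η hηL c₀ c₁ hw hρ m hm U αU hα0 hα1 hU1 hreg εU hεU hUε hLb α hα (hαle'.trans hαsD) hUst hUb hUη hpl hUgrad hεg hAQ A₀ hA₀ hpos₀ PB
      hPB v f (fun b hb => hfv b hb) F hF hfF x
    rw [hDcl, hAcl, ContinuousLinearMap.comp_apply, LinearMap.coe_toContinuousLinearMap', LinearMap.coe_toContinuousLinearMap']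
    exact h.trans (mul_le_mul_of_nonneg_right (mul_le_mul_of_nonneg_left (exp_weaken hκD (tdist_nonneg m _ _)) hBD) hF)
  have hAk : ∀ (v : TSite d m) (f : BondL2K ℂ d (towerP L m (n + 1)) c₀ W) (F : ℝ),
      (∀ x, blockCoord (L ^ (n + 1)) m (siteCast (towerP_eq_fineP_pow L m (n + 1)) (bpos x)) ≠ v →
        WL2.equiv ℂ (fun _ : Bond d (towerP L m (n + 1)) => c₀) W f x = 0) →
      (∀ x, ‖WL2.equiv ℂ (fun _ : Bond d (towerP L m (n + 1)) => c₀) W f x‖ ≤ F) →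
      ∀ x, ‖WL2.equiv ℂ (fun _ : Bond d (towerP L m (n + 1)) => c₀) W (Acl f) x‖ ≤
        BA * Real.exp (-(κ * tdist m (blockCoord (L ^ (n + 1)) m (siteCast (towerP_eq_fineP_pow L m (n + 1)) (bpos x))) v)) * F := by
    intro v f F hfv hfF x
    have hF : 0 ≤ F := (norm_nonneg _).trans (hfF x)
    have h := HA n η hηL c₀ c₁ hw hρ m hm U αU hα0 hα1 hU1 hreg εU hεU hUε hLb α hα (hαle.trans ((min_le_left _ _).trans (min_le_left _ _)))
      hUst hUb hUη hpl hεg hAQ A₀ hA₀ hpos₀ PB hPB v f hfv F hF hfF x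
    rw [hAcl, LinearMap.coe_toContinuousLinearMap']
    exact h.trans (mul_le_mul_of_nonneg_right (mul_le_mul_of_nonneg_left (exp_weaken hκA (tdist_nonneg m _ _)) hBA) hF)
  have hUk : ∀ (v : TSite d m) (g : SiteL2K ℂ d m c₁ W) (F : ℝ), (∀ u, id u ≠ v → WL2.equiv ℂ (fun _ : TSite d m => c₁) W g u = 0) →
      (∀ u, ‖WL2.equiv ℂ (fun _ : TSite d m => c₁) W g u‖ ≤ F) →
      ∀ x, ‖WL2.equiv ℂ (fun _ : Bond d (towerP L m (n + 1)) => c₀) W (Ucl g) x‖ ≤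
        BU * Real.exp (-(κ * tdist m (blockCoord (L ^ (n + 1)) m (siteCast (towerP_eq_fineP_pow L m (n + 1)) (bpos x))) v)) * F := by
    intro v g F hgv hgF x
    obtain ⟨y₀⟩ : Nonempty (TSite d m) := ⟨v⟩
    have hF : 0 ≤ F := (norm_nonneg _).trans (hgF v)
    have h := HB n η hηL c₀ c₁ hw hρ m hm U αU hα0 hα1 hU1 hreg εU hεU hUε hLb α hα (hαle.trans ((min_le_right _ _).trans (min_le_right _ _)))
      hUst hUb hUη hpl hUgrad hRlev hεg hAQ hpos' v g F (fun y hy => hgv y hy) hgF x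
    rw [hUcl, LinearMap.coe_toContinuousLinearMap', hUu]
    exact h.trans (mul_le_mul_of_nonneg_right (mul_le_mul_of_nonneg_left (exp_weaken hκB (tdist_nonneg m _ _)) hBU) hF)
  have hCk : ∀ (v : TSite d m) (g : SiteL2K ℂ d m c₁ W) (F : ℝ), (∀ u, id u ≠ v → WL2.equiv ℂ (fun _ : TSite d m => c₁) W g u = 0) →
      (∀ u, ‖WL2.equiv ℂ (fun _ : TSite d m => c₁) W g u‖ ≤ F) →
      ∀ u, ‖WL2.equiv ℂ (fun _ : TSite d m => c₁) W (Ccl g) u‖ ≤ BC * Real.exp (-(κ * tdist m (id u) v)) * F := by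
    intro v g F hgv hgF u
    have hF : 0 ≤ F := (norm_nonneg _).trans (hgF v)
    have h := HC n η hηL c₀ c₁ hw hρ m hm U αU hα1 hU1 hreg εU hεU hUε hLb α hα (hαle.trans ((min_le_right _ _).trans (min_le_left _ _)))
      hUst hUb hUη hpl hεg hpos' rY hrY v g F (fun y hy => hgv y hy) hgF u
    rw [hCcl, LinearMap.coe_toContinuousLinearMap', hc]
    exact h.trans (mul_le_mul_of_nonneg_right (mul_le_mul_of_nonneg_left (exp_weaken hκC (tdist_nonneg m _ _)) hBC) hF)
  have hGk : ∀ z z', ‖PB z' ∘L Gcl ∘L PB z‖ ≤ A₁ * Real.exp (-(κ * tdist m z z')) := by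
    intro z z'
    rw [hGcl]
    have h := HG n η hηL c₀ c₁ hw hρ m hm U αU hα0 hα1 hU1 hreg εU hεU hUε hLb α hα (hαle.trans ((min_le_left _ _).trans (min_le_right _ _)))
      hUst hUb hUη hpl hεg hpos PB hPB z z'
    exact h.trans (mul_le_mul_of_nonneg_left (exp_weaken hκG (tdist_nonneg m _ _)) hA₁)
  -- the bond-block mass `d·c₁`
  have hμB : ∀ u : TSite d m, ∑ x : Bond d (towerP L m (n + 1)),
      (if blockCoord (L ^ (n + 1)) m (siteCast (towerP_eq_fineP_pow L m (n + 1)) (bpos x)) = u then c₀ else 0) ≤ (d : ℝ) * c₁ := by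
    intro u
    have h := sum_bondMass_bigBlock_le L m n hc₀.le u
    calc _ ≤ c₀ * (d * ((L : ℝ) ^ (n + 1)) ^ d) := h
      _ = (d : ℝ) * c₁ := by rw [← hw]; ring
  -- the assembly
  haveI : Nonempty (Bond d (towerP L m (n + 1))) := ⟨(y, ⟨0, hd⟩)⟩
  have hκ' : κ / 2 < κ := by linarith
  have h := local_letter_postcomp_torus_const (𝕜 := ℂ) (V := W) (VX := W)
    (fun x : Bond d (towerP L m (n + 1)) => blockCoord (L ^ (n + 1)) m (siteCast (towerP_eq_fineP_pow L m (n + 1)) (bpos x)))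
    (fun x : TSite d (towerP L m (n + 1)) => blockCoord (L ^ (n + 1)) m (siteCast (towerP_eq_fineP_pow L m (n + 1)) x)) hPB hrY
    Acl Gcl Ucl Vcl Ccl Dcl hm hW hVadj hAadj (dB := d) hBD hBA hBU hBC hA₁ (by positivity) hκ' hc₁ (fun _ => rfl) (Nat.cast_nonneg d) hμB
    hDAk hAk hUk hCk hGk v f F hfv hfF y
  rw [hGcl, hDcl, LinearMap.coe_toContinuousLinearMap', LinearMap.coe_toContinuousLinearMap'] at h
  exact h

/-! ## §2 The letter of `Uu = D_UG′_kQ̃′_k†` from the owner's closed gradient row (as in (K64) §2), and THE END -/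

include hd hL hL3 hMφ hMφ' hφ hφ' hstar ha ha' hϱ0 hϱ1 hτ hCτ hτm hMτ hρw hτ₁ hτ₂ hφτ in
/-- **THE DIVERGENCE ROW OF `G₁,k(U)` ON PRINT's DIAGONAL, UNCONDITIONAL on the cell's MODEL letters** ([B9] Thm 3.3: `G(U)` satisfies (3.42) — here its
second member in DIVERGENCE form for the bond propagator at `k = n+1` levels): §1 with `HU` INHABITED by the NE9 owner's
`B9Eq342GreenPrimeTowerGradientRowClosed.exists_gradRow_GpOfUk` read on the unit point sources `h = Q̃′_k†g` — VERBATIM the plumbing of ne9-leaf-05's (K64) §2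
(`adjoint_QtildeTower_apply_eq_of_eq_at`, `norm_adjoint_QtildeTower_apply_le` × `norm_le_sqrt_mass_mul`, `tdist_bigBlock_bpos_btgt_le_one`), credited.
[cite: Balaban1985BackgroundPropagators, Thm 3.3 p.399, Thm 3.1 (3.42) p.397, (3.8) p.392, (3.25)–(3.26) pp.394–395, (3.19) p.393, Thm 3.11 p.416] -/
theorem exists_divergence_row_G1k :
    ∃ α₁ B δ : ℝ, 0 < α₁ ∧ 0 ≤ B ∧ 0 < δ ∧
      ∀ (n : ℕ) (η : ℝ) (_hηL : η * (L : ℝ) ^ (n + 1) = 1) (c₀ c₁ : ℝ) [Fact (0 < c₀)] [Fact (0 < c₁)]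
        (_hw : c₀ * ((L : ℝ) ^ (n + 1)) ^ d = c₁) (_hρ : |η| ^ d / c₀ ≤ ρw) (m : Fin d → ℕ) [∀ i, NeZero (m i)] (_hm : ∀ i, 1 ≤ m i)
        (U : Bond d (towerP L m (n + 1)) → 𝔸ˣ) (αU : ℕ → ℝ) (_hα0 : ∀ j, 0 ≤ αU j) (hα1 : ∀ j, αU j ≤ 1 / 64)
        (hU1 : ∀ (j : ℕ) (x : B7Prop1Explicit.Site d) (k : Fin d), perCfg (towerP L m (j + 1)) (UlevOf L m (n + 1) U j) x k ∈ U1 𝔸)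
        (hreg : ∀ (j : ℕ) (y : TSite d (towerP L m j)) (k : Fin d) (ρ' : Fin d → Fin L),
          ‖((Wcx L (perCfg (towerP L m (j + 1)) (UlevOf L m (n + 1) U j)) (cornerSite L y) k (boxVec L ρ') : 𝔸ˣ) : 𝔸) - 1‖ ≤ αU j)
        (εU : ℕ → ℝ) (_hεU : ∀ j, 0 ≤ εU j) (_hUε : ∀ (j : ℕ) (b : Bond d (towerP L m (j + 1))), ‖(UlevOf L m (n + 1) U j b : 𝔸) - 1‖ ≤ εU j)
        (_hLb : ∀ (j : ℕ) (b : Bond d (towerP L m (j + 1))), UlevOf L m (n + 1) U j b ∈ U1 𝔸)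
        (α : ℝ) (_hα : 0 ≤ α) (_hαle : α ≤ α₁)
        (hUst : ∀ b, star (U b : 𝔸) = (((U b)⁻¹ : 𝔸ˣ) : 𝔸)) (_hUb : ∀ b, U b ∈ U1 𝔸) (_hUη : ∀ b, ‖(U b : 𝔸) - 1‖ ≤ α * η)
        (_hpl : ∀ p : B9SectCLatticeCarrier.Plaq d (towerP L m (n + 1)), ‖(plaqHolU U p : 𝔸) - 1‖ ≤ α * η ^ 2)
        (_hUgrad : ∀ (x : TSite d (towerP L m (n + 1))) (μ : Fin d), ‖(U (x, μ) : 𝔸) - U (unshift μ x, μ)‖ ≤ α * η ^ 2)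
        (_hRlev : ∀ (j : ℕ) (b : Bond d (towerP L m (j + 1))) (w : W), ‖adTransportW φ (UlevOf L m (n + 1) U j) b w‖ ≤ ‖w‖)
        (_hεg : ∀ j < n + 1, εU j ≤ α * ϱ ^ j) (_hAQ : ∑ j ∈ Finset.range (n + 1), αU j ≤ AQ)
        (hpos' : ∀ x : SiteL2K ℂ d (towerP L m (n + 1)) c₀ W, x ≠ 0 → 0 < RCLike.re ⟪x, laplacePrimeAk L m n φ η U a' (c₁ := c₁) x⟫_ℂ)
        (hpos : ∀ x : BondL2K ℂ d (towerP L m (n + 1)) c₀ W, x ≠ 0 →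
          0 < RCLike.re ⟪x, laplaceAk L m n φ η U hL αU hα1 hU1 hreg τ (c₀ := c₀) (c₁ := c₁) a x⟫_ℂ)
        (v : TSite d m) (f : BondL2K ℂ d (towerP L m (n + 1)) c₀ W) (F : ℝ)
        (_hfv : ∀ b, blockCoord (L ^ (n + 1)) m (siteCast (towerP_eq_fineP_pow L m (n + 1)) (bpos b)) ≠ v →
          WL2.equiv ℂ (fun _ : Bond d (towerP L m (n + 1)) => c₀) W f b = 0)
        (_hfF : ∀ b, ‖WL2.equiv ℂ (fun _ : Bond d (towerP L m (n + 1)) => c₀) W f b‖ ≤ F) (y : TSite d (towerP L m (n + 1))),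
        ‖WL2.equiv ℂ (fun _ : TSite d (towerP L m (n + 1)) => c₀) W (covDivL2K ℂ c₀ ((η : ℂ))⁻¹ (adTransportW φ fun bb => (U bb)⁻¹)
            (G1k L m n φ η U hL αU hα1 hU1 hreg τ (c₀ := c₀) (c₁ := c₁) hpos f)) y‖ ≤
          B * Real.exp (-(δ * tdist m (blockCoord (L ^ (n + 1)) m (siteCast (towerP_eq_fineP_pow L m (n + 1)) y)) v)) * F := by
  classical
  have hL2 : 2 ≤ L := le_trans (by norm_num) hL3
  obtain ⟨α₂, BD, κ', hα₂, hBD, hκ', HD⟩ := exists_gradRow_GpOfUk L φ hMφ hMφ' hφ hφ' ha' hϱ0 hϱ1 τ hτ₂ hφτ hd hL2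
  refine exists_divergence_row_G1k_of_UuLetter hd L hL hL3 φ hMφ hMφ' hφ hφ' hstar ha ha' hϱ0 hϱ1 τ hτ hCτ hτm hMτ hρw hτ₁ hτ₂ hφτ AQ
    ⟨α₂, BD * Real.exp κ', κ', hα₂, by positivity, hκ', ?_⟩
  intro n η hηL c₀ c₁ _ _ hw hρ m _ hm U αU hα0 hα1 hU1 hreg εU hεU hUε hLb α hα hαle hUst hUb hUη hpl hUgrad hRlev hεg hAQ hpos' v g Gs hgv hgG b
  have hc₀ : (0 : ℝ) < c₀ := Fact.out
  have hc₁ : (0 : ℝ) < c₁ := Fact.out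
  have hG0 : 0 ≤ Gs := (norm_nonneg _).trans (hgG v)
  have hRS : ∀ (b : Bond d (towerP L m (n + 1))) (v u : W), ⟪adTransportW φ U b v, u⟫_ℂ = ⟪v, adTransportW φ (fun b => (U b)⁻¹) b u⟫_ℂ :=
    adTransportW_adjoint φ τ hτ₂ hUst hφτ
  -- the site block family the gradient row wants
  obtain ⟨PS, hPS⟩ := exists_block_clm_family (𝕜 := ℂ) (w := fun _ : TSite d (towerP L m (n + 1)) => c₀) (V := W)
    (fun x : TSite d (towerP L m (n + 1)) => blockCoord (L ^ (n + 1)) m (siteCast (towerP_eq_fineP_pow L m (n + 1)) x))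
  -- `h := Q̃′_k†g`: supported in the big block over `v`, bounded by `G` on the diagonal
  set h : SiteL2K ℂ d (towerP L m (n + 1)) c₀ W :=
    LinearMap.adjoint ((WL2.linearEquiv ℂ ℂ (fun _ : TSite d m => c₁)).symm.toLinearMap ∘ₗ QprimeTowerW L m n φ U (c₀ := c₀)) g with hh
  have hsupp : ∀ x, blockCoord (L ^ (n + 1)) m (siteCast (towerP_eq_fineP_pow L m (n + 1)) x) ≠ v →
      WL2.equiv ℂ (fun _ : TSite d (towerP L m (n + 1)) => c₀) W h x = 0 := by
    intro x hx
    have e := adjoint_QtildeTower_apply_eq_of_eq_at L m n φ (c₀ := c₀) U g 0 x (fun z hz => by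
      have hz' : blockCoord (L ^ (n + 1)) m (siteCast (towerP_eq_fineP_pow L m (n + 1)) x) = z := (bigBlock_eq_iff L m n x z).2 hz
      have hzv : z ≠ v := fun hzv => hx (hz'.trans hzv)
      rw [hgv z hzv, WL2.equiv_zero, Pi.zero_apply])
    rw [hh, e, map_zero, WL2.equiv_zero, Pi.zero_apply]
  have hμ : ∑ y : TSite d m, (if id y = v then c₁ else 0) ≤ c₁ := by
    show ∑ y : TSite d m, (if y = v then c₁ else 0) ≤ c₁
    rw [Finset.sum_ite_eq' Finset.univ v (fun _ => c₁), if_pos (Finset.mem_univ _)]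
  have hgn : ‖g‖ ≤ Real.sqrt c₁ * Gs := norm_le_sqrt_mass_mul (π := id) (w := fun _ : TSite d m => c₁) v hμ g hG0 (fun y hy => hgv y hy) hgG
  have hsize : ∀ x, ‖WL2.equiv ℂ (fun _ : TSite d (towerP L m (n + 1)) => c₀) W h x‖ ≤ Gs := by
    intro x
    have e := norm_adjoint_QtildeTower_apply_le L m n φ (c₀ := c₀) U hRlev g x
    rw [hh]
    refine e.trans ?_
    have hLp : (0 : ℝ) < ((L : ℝ) ^ (n + 1)) ^ d := by positivity
    calc Real.sqrt c₁ * (((L : ℝ) ^ (n + 1)) ^ d)⁻¹ / c₀ * ‖g‖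
        ≤ Real.sqrt c₁ * (((L : ℝ) ^ (n + 1)) ^ d)⁻¹ / c₀ * (Real.sqrt c₁ * Gs) := by gcongr
      _ = c₁ / (c₀ * ((L : ℝ) ^ (n + 1)) ^ d) * Gs := by
          rw [show Real.sqrt c₁ * (((L : ℝ) ^ (n + 1)) ^ d)⁻¹ / c₀ * (Real.sqrt c₁ * Gs) =
            Real.sqrt c₁ * Real.sqrt c₁ * ((((L : ℝ) ^ (n + 1)) ^ d)⁻¹ / c₀) * Gs by ring, Real.mul_self_sqrt hc₁.le]
          field_simp
      _ = Gs := by rw [← hw, div_self (ne_of_gt (by positivity)), one_mul]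
  -- the owner's gradient row at `h`, then the tip → base junction
  have hrow := HD n η hηL c₀ c₁ hw m U hRS α hα hαle hUb hUη hUgrad εU hεU hεg hUε hLb hUst hRlev hpos' PS hPS v h Gs hG0 hsupp hsize b
  have htri := tdist_triangle hm (blockCoord (L ^ (n + 1)) m (siteCast (towerP_eq_fineP_pow L m (n + 1)) (bpos b)))
    (blockCoord (L ^ (n + 1)) m (siteCast (towerP_eq_fineP_pow L m (n + 1)) (btgt b))) v
  have hone := tdist_bigBlock_bpos_btgt_le_one (L := L) (m := m) (k := n + 1) hm b
  have hexp : Real.exp (-(κ' * tdist m (blockCoord (L ^ (n + 1)) m (siteCast (towerP_eq_fineP_pow L m (n + 1)) (btgt b))) v)) ≤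
      Real.exp κ' * Real.exp (-(κ' * tdist m (blockCoord (L ^ (n + 1)) m (siteCast (towerP_eq_fineP_pow L m (n + 1)) (bpos b))) v)) := by
    rw [← Real.exp_add]
    exact Real.exp_le_exp.2 (by nlinarith [hκ'.le])
  have e : (covDerivL2K ℂ c₀ ((η : ℂ))⁻¹ (adTransportW φ U) ∘ₗ GpOfUk L m n φ η U a' (c₁ := c₁) hpos' ∘ₗ
      LinearMap.adjoint ((WL2.linearEquiv ℂ ℂ (fun _ : TSite d m => c₁)).symm.toLinearMap ∘ₗ QprimeTowerW L m n φ U (c₀ := c₀))) g =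
      covDerivL2K ℂ c₀ ((η : ℂ))⁻¹ (adTransportW φ U) (GpOfUk L m n φ η U a' (c₁ := c₁) hpos' h) := by
    rw [hh]; rfl
  rw [e]
  calc _ ≤ BD * Gs * Real.exp (-(κ' * tdist m (blockCoord (L ^ (n + 1)) m (siteCast (towerP_eq_fineP_pow L m (n + 1)) (btgt b))) v)) := hrow
    _ ≤ BD * Gs * (Real.exp κ' * Real.exp (-(κ' * tdist m (blockCoord (L ^ (n + 1)) m (siteCast (towerP_eq_fineP_pow L m (n + 1)) (bpos b))) v))) :=
        mul_le_mul_of_nonneg_left hexp (mul_nonneg hBD hG0)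
    _ = BD * Real.exp κ' * Real.exp (-(κ' * tdist m (blockCoord (L ^ (n + 1)) m (siteCast (towerP_eq_fineP_pow L m (n + 1)) (bpos b))) v)) * Gs := by
        ring

end Literature.MathematicalPhysics.QuantumFieldTheory.Balaban1983to89.B9Eq326G1kDivergenceRowClosed

end
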